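import Literature.Geometry.Riemannian.SphericalCylinderEntropy
import HarnessLib

/-!
# Blowing up the cylinder `S⁴ × ℝ ⊂ ℝ⁶` at a point: convergence to the tangent hyperplane

Topic `Literature/Geometry/Riemannian`.  Let `N = {z ∈ ℝ⁶ : |z'| = 1}` (`z'` the first five
coordinates, `truncL`).  Blowing up at `z₀ ∈ N` by the factor `λ > 0`, i.e. looking at the points
`w` with `z₀ + λ⁻¹ w ∈ N`, one finds the exact identity

  `⟪z₀', w'⟫ = -|w'|² / (2λ)`            (`inner_truncL_eq_of_mem_blowUp`),

so `|⟪z₀', w'⟫| ≤ |w|²/(2λ)` (`abs_inner_truncL_le_of_mem_blowUp`): inside any ball `B(0, R)` the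
blown-up cylinder lies within `R²/(2λ)` of the tangent hyperplane `{w : ⟪z₀', w'⟫ = 0}`, and limits
of points `wᵢ` of blow-ups with `λᵢ → ∞`, `zᵢ' → e`, lie in the hyperplane `{⟪e, w'⟫ = 0}`
(`inner_eq_zero_of_tendsto_blowUp`).  This is why blow-up limits of flows in `S⁴ × ℝ` are flows in
a fixed hyperplane `ℝ⁵ ⊂ ℝ⁶` (White 2005, §4, reduction of Thm. 4.1 to the Euclidean case).

Everything is PROVED; no definitions, no named facts.

## References

* B. White, *A local regularity theorem for mean curvature flow*, Ann. of Math. 161 (2005), §4.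
  [White2005]
-/

noncomputable section

open Filter
open scoped RealInnerProductSpace Topology

namespace Literature.Geometry.Riemannian

open SphericalCylinderEntropy (truncL truncL_apply norm_truncL_le)

/-- **Exact deviation of the blown-up cylinder from its tangent hyperplane**: if `|z₀'| = 1` and
`|(z₀ + λ⁻¹ w)'| = 1` with `λ ≠ 0`, then `⟪z₀', w'⟫ = -|w'|²/(2λ)`. [cite: White2005, §4] -/
theorem inner_truncL_eq_of_mem_blowUp {z₀ w : EuclideanSpace ℝ (Fin 6)} {lam : ℝ} (hlam : lam ≠ 0)
    (hz₀ : ‖truncL z₀‖ = 1) (hw : ‖truncL (z₀ + lam⁻¹ • w)‖ = 1) :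
    ⟪truncL z₀, truncL w⟫ = -‖truncL w‖ ^ 2 / (2 * lam) := by
  have h1 : ‖truncL (z₀ + lam⁻¹ • w)‖ ^ 2 = 1 := by rw [hw, one_pow]
  rw [map_add, map_smul, norm_add_sq_real, norm_smul, hz₀, real_inner_smul_right, mul_pow,
    Real.norm_eq_abs, sq_abs] at h1
  -- `h1 : 1 + 2 * (lam⁻¹ * ⟪z₀', w'⟫) + lam⁻¹ ^ 2 * |w'|² = 1`
  field_simp
  have h2 : 2 * ⟪truncL z₀, truncL w⟫ * lam + ‖truncL w‖ ^ 2 = 0 := by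
    have h3 : lam ^ 2 * (2 * (lam⁻¹ * ⟪truncL z₀, truncL w⟫) + lam⁻¹ ^ 2 * ‖truncL w‖ ^ 2) = 0 := by
      rw [show 2 * (lam⁻¹ * ⟪truncL z₀, truncL w⟫) + lam⁻¹ ^ 2 * ‖truncL w‖ ^ 2 = 0 by linarith,
        mul_zero]
    have : lam ^ 2 * (2 * (lam⁻¹ * ⟪truncL z₀, truncL w⟫) + lam⁻¹ ^ 2 * ‖truncL w‖ ^ 2) =
        2 * ⟪truncL z₀, truncL w⟫ * lam + ‖truncL w‖ ^ 2 := by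
      field_simp
    rw [this] at h3
    exact h3
  linarith

/-- Hence `|⟪z₀', w'⟫| ≤ |w|² / (2λ)` for `λ > 0`. [cite: White2005, §4] -/
theorem abs_inner_truncL_le_of_mem_blowUp {z₀ w : EuclideanSpace ℝ (Fin 6)} {lam : ℝ}
    (hlam : 0 < lam) (hz₀ : ‖truncL z₀‖ = 1) (hw : ‖truncL (z₀ + lam⁻¹ • w)‖ = 1) :
    |⟪truncL z₀, truncL w⟫| ≤ ‖w‖ ^ 2 / (2 * lam) := by
  rw [inner_truncL_eq_of_mem_blowUp hlam.ne' hz₀ hw, abs_div, abs_neg, abs_of_nonneg (sq_nonneg _),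
    abs_of_pos (by positivity)]
  exact div_le_div_of_nonneg_right (pow_le_pow_left₀ (norm_nonneg _) (norm_truncL_le w) 2)
    (by positivity)

/-- **Limits of points of blow-ups lie in the limit hyperplane**: if `|zᵢ'| = 1`,
`|(zᵢ + λᵢ⁻¹ wᵢ)'| = 1`, `λᵢ → ∞` (`λᵢ > 0`), `zᵢ' → e` and `wᵢ → w`, then `⟪e, w'⟫ = 0`.
[cite: White2005, §4] -/
theorem inner_eq_zero_of_tendsto_blowUp {z : ℕ → EuclideanSpace ℝ (Fin 6)}
    {w : ℕ → EuclideanSpace ℝ (Fin 6)} {lam : ℕ → ℝ} (hlam : ∀ i, 0 < lam i)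
    (hlim : Tendsto lam atTop atTop) (hz : ∀ i, ‖truncL (z i)‖ = 1)
    (hw : ∀ i, ‖truncL (z i + (lam i)⁻¹ • w i)‖ = 1)
    {e : EuclideanSpace ℝ (Fin 5)} (he : Tendsto (fun i => truncL (z i)) atTop (𝓝 e))
    {w₀ : EuclideanSpace ℝ (Fin 6)} (hw₀ : Tendsto w atTop (𝓝 w₀)) :
    ⟪e, truncL w₀⟫ = 0 := by
  -- `⟪zᵢ', wᵢ'⟫ → ⟪e, w₀'⟫`
  have h1 : Tendsto (fun i => ⟪truncL (z i), truncL (w i)⟫) atTop (𝓝 ⟪e, truncL w₀⟫) :=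
    he.inner ((truncL.continuous.tendsto w₀).comp hw₀)
  -- and `|⟪zᵢ', wᵢ'⟫| ≤ |wᵢ|²/(2λᵢ) → 0`
  have hbd : ∃ B, ∀ᶠ i in atTop, ‖w i‖ ^ 2 ≤ B := by
    have h := (continuous_norm.tendsto w₀).comp hw₀
    refine ⟨(‖w₀‖ + 1) ^ 2, ?_⟩
    filter_upwards [h (Iio_mem_nhds (lt_add_one ‖w₀‖))] with i hi
    exact pow_le_pow_left₀ (norm_nonneg _) (le_of_lt hi) 2
  obtain ⟨B, hB⟩ := hbd
  have hB0 : 0 ≤ B := by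
    obtain ⟨i, hi⟩ := hB.exists
    exact (sq_nonneg _).trans hi
  have h2 : Tendsto (fun i => B / (2 * lam i)) atTop (𝓝 0) := by
    have := (hlim.const_mul_atTop (show (0 : ℝ) < 2 by norm_num)).inv_tendsto_atTop.const_mul B
    simpa [div_eq_mul_inv] using this
  have h3 : Tendsto (fun i => ⟪truncL (z i), truncL (w i)⟫) atTop (𝓝 0) := by
    refine squeeze_zero_norm' ?_ h2
    filter_upwards [hB] with i hi
    rw [Real.norm_eq_abs]
    exact (abs_inner_truncL_le_of_mem_blowUp (hlam i) (hz i) (hw i)).trans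
      (div_le_div_of_nonneg_right hi (by have := hlam i; positivity))
  exact tendsto_nhds_unique h1 h3

end Literature.Geometry.Riemannian
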